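import Mathlib
import Literature.Combinatorics.Enumerative.InvolutionsAvoiding4321And132
import HarnessLib

/-!
# Centrosymmetric involutions avoiding `4321` and `132`: `|CI_n(4321, 132)| = ⌊n/2⌋ + 1` (Barnabei–Bonetti–Silimbani 2011, Theorem 14 (i), corrected)

Layer `Literature/Combinatorics/Enumerative`, namespace `Literature.Combinatorics.Enumerative.PermContainsPattern`; lane
`lit-hodgefound` (prover seat p13, generation 39, theme «nonnesting / noncrossing matchings and restricted
involutions»).  Sequel of `InvolutionsAvoiding4321And132.lean` (THEOREM 5 (i): `I_n(4321, 132)` consists of the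
involutions `U^a H^b D^a H^c` = `blockArc n a b`).

## Source, and a correction

M. Barnabei, F. Bonetti, M. Silimbani, *Restricted involutions and Motzkin paths*, Adv. Appl. Math. **47** (2011)
102–115 = arXiv:0812.0463 [BarnabeiBonettiSilimbani2011] (held text `paper-arxiv-0812.0463`, arXiv numbering, §7):

> A centrosymmetric involution is an element `τ ∈ I_n` such that `τ_{rc} = τ`, namely, an involution such that
> `τ(i) + τ(n+1−i) = n + 1`, for every `1 ≤ i ≤ n`. Denote by `CI_n` the set of centrosymmetric involutions in `I_n`.
> **Theorem 14.** We have: i. `|CI_n(4321,132)| = ⌊n/2⌋`; …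
> Proof. i. as stated in Theorem 5.i, involutions avoiding both `4321` and `132` are in bijection with Motzkin paths
> of the kind `M = U^a H^b D^a H^c`. Among these, only the `⌊n/2⌋` with `c = 0` are symmetric.

**Correction.** The symmetric paths `U^a H^{n−2a} D^a` are `⌊n/2⌋ + 1` in number (`0 ≤ a ≤ ⌊n/2⌋`: the printed count
omits `a = 0`, the identity, which is centrosymmetric and avoids `4321` and `132`); e.g. `CI_2(4321, 132) = {12, 21}`
has two elements, not `⌊2/2⌋ = 1`, and `CI_1(4321,132) = {1}` has one, not `0`.  We prove the corrected statement
`|CI_n(4321, 132)| = ⌊n/2⌋ + 1` (`card_centrosymmetric_av4321_av132`) by the printed argument, and record the two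
small counterexamples to the printed value (`card_centrosymmetric_av4321_av132_one`, `_two`).

## Formalisation (arc language; theorems only)

Centrosymmetry of `u : Perm (Fin n)` is the condition `∀ i, u (rev i) = rev (u i)` (`τ_{rc} = τ`).
* §1 `blockArc_centrosymmetric_iff`: `U^a H^b D^a H^c` (normalised: `a = 0 → b = 0`) is centrosymmetric iff `a = 0` or
  `c = 0`.
* §2 ★★★ `card_centrosymmetric_av4321_av132 : |CI_n(4321, 132)| = n/2 + 1` (the bijection `a ↦ U^a H^{n−2a} D^a` from
  `[0, n/2]`), values, and the counterexamples to the printed `⌊n/2⌋`.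
-/

namespace Literature.Combinatorics.Enumerative

namespace PermContainsPattern

open Finset Equiv

variable {n : ℕ}

/-! ### §1 Which `U^a H^b D^a H^c` are centrosymmetric -/

/-- `U^a H^b D^a H^c` (with the normalisation `a = 0 → b = 0` of `eq_blockArc`) is centrosymmetric iff `a = 0` (the
identity) or `c = n − 2a − b = 0`. [cite: BarnabeiBonettiSilimbani2011, Theorem 14 (i) (proof: «only the … with `c = 0`
are symmetric»; arXiv 0812.0463)] -/
theorem blockArc_centrosymmetric_iff (n a b : ℕ) (h : 2 * a + b ≤ n) (hab : a = 0 → b = 0) :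
    (∀ i : Fin n, blockArc n a b h (Fin.rev i) = Fin.rev (blockArc n a b h i)) ↔ a = 0 ∨ 2 * a + b = n := by
  constructor
  · intro hcs
    by_contra hc
    push Not at hc
    obtain ⟨m, rfl⟩ : ∃ m, n = m + 1 := ⟨n - 1, by omega⟩
    have := congrArg Fin.val (hcs (Fin.last m))
    rw [Fin.rev_last, Fin.val_rev, blockArc_val, blockArc_val, Fin.val_zero, Fin.val_last] at this
    split_ifs at this <;> omega
  · intro hc i
    apply Fin.ext
    rw [blockArc_val, Fin.val_rev, Fin.val_rev, blockArc_val]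
    have hi := i.2
    rcases hc with rfl | hc
    · have hb := hab rfl
      subst hb
      split_ifs <;> omega
    · split_ifs <;> omega

/-- In particular `U^a H^{n−2a} D^a` is centrosymmetric. [cite: BarnabeiBonettiSilimbani2011, Theorem 14 (i) (arXiv 0812.0463)] -/
theorem blockArc_centrosymmetric (n a : ℕ) (ha : 2 * a ≤ n) (i : Fin n) :
    blockArc n a (n - 2 * a) (by omega) (Fin.rev i) = Fin.rev (blockArc n a (n - 2 * a) (by omega) i) := by
  apply Fin.ext
  rw [blockArc_val, Fin.val_rev, Fin.val_rev, blockArc_val]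
  have hi := i.2
  split_ifs <;> omega

/-! ### §2 THEOREM 14 (i), corrected: `|CI_n(4321, 132)| = ⌊n/2⌋ + 1` -/

/-- ★★★ **THEOREM 14 (i) (Barnabei–Bonetti–Silimbani), corrected: `|CI_n(4321, 132)| = ⌊n/2⌋ + 1`.** The centrosymmetric
involutions avoiding `4321` and `132` are the `U^a H^{n−2a} D^a`, `0 ≤ a ≤ ⌊n/2⌋` (the source prints `⌊n/2⌋`, omitting
the identity `a = 0`). [cite: BarnabeiBonettiSilimbani2011, Theorem 14 (i) (arXiv 0812.0463; printed value `⌊n/2⌋`, off by one)] -/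
theorem card_centrosymmetric_av4321_av132 (n : ℕ) :
    Nat.card {u : Perm (Fin n) // (u * u = 1 ∧ ¬ PermContainsPattern u ![4, 3, 2, 1] ∧ ¬ PermContainsPattern u ![1, 3, 2]) ∧
      ∀ i, u (Fin.rev i) = Fin.rev (u i)} = n / 2 + 1 := by
  let f : Fin (n / 2 + 1) → {u : Perm (Fin n) // (u * u = 1 ∧ ¬ PermContainsPattern u ![4, 3, 2, 1] ∧
      ¬ PermContainsPattern u ![1, 3, 2]) ∧ ∀ i, u (Fin.rev i) = Fin.rev (u i)} := fun a =>
    ⟨blockArc n a (n - 2 * a) (by have := a.2; omega), blockArc_mem _ _ _ _,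
      blockArc_centrosymmetric n a (by have := a.2; omega)⟩
  have hf : Function.Bijective f := by
    constructor
    · intro a a' e
      have e' := congrArg (fun u : {u : Perm (Fin n) // (u * u = 1 ∧ ¬ PermContainsPattern u ![4, 3, 2, 1] ∧
          ¬ PermContainsPattern u ![1, 3, 2]) ∧ ∀ i, u (Fin.rev i) = Fin.rev (u i)} =>
        (univ.filter fun z : Fin n => z < u.1 z).card) e
      simp only [f, card_openers_blockArc] at e'
      exact Fin.ext e'
    · rintro ⟨u, ⟨hinv, h4321, h132⟩, hcs⟩
      obtain ⟨a, b, h, hab, rfl⟩ := eq_blockArc ((mul_self_eq_one_iff_apply_apply _).1 hinv) h4321 h132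
      rcases (blockArc_centrosymmetric_iff n a b h hab).1 hcs with rfl | hc
      · have hb := hab rfl
        subst hb
        refine ⟨⟨0, Nat.succ_pos _⟩, Subtype.ext (Equiv.ext fun y => Fin.ext ?_)⟩
        simp only [f]
        rw [blockArc_val, blockArc_val]
        split_ifs <;> omega
      · refine ⟨⟨a, by omega⟩, Subtype.ext ?_⟩
        simp only [f]
        obtain rfl : b = n - 2 * a := by omega
        rfl
  rw [← Nat.card_congr (Equiv.ofBijective f hf), Nat.card_eq_fintype_card, Fintype.card_fin]

/-- Values: `|CI_n(4321, 132)| = 1, 1, 2, 2, 3, 3, 4` for `n = 0, …, 6`. [cite: BarnabeiBonettiSilimbani2011, Theorem 14 (i) (arXiv 0812.0463; corrected)] -/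
theorem card_centrosymmetric_av4321_av132_values :
    (List.range 7).map (fun n => Nat.card {u : Perm (Fin n) // (u * u = 1 ∧ ¬ PermContainsPattern u ![4, 3, 2, 1] ∧
      ¬ PermContainsPattern u ![1, 3, 2]) ∧ ∀ i, u (Fin.rev i) = Fin.rev (u i)}) = [1, 1, 2, 2, 3, 3, 4] := by
  simp only [card_centrosymmetric_av4321_av132]
  decide

/-- Counterexample to the printed value at `n = 1`: `CI_1(4321, 132) = {1}` has one element, not `⌊1/2⌋ = 0`.
[cite: BarnabeiBonettiSilimbani2011, Theorem 14 (i) (arXiv 0812.0463; printed `⌊n/2⌋`)] -/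
theorem card_centrosymmetric_av4321_av132_one :
    Nat.card {u : Perm (Fin 1) // (u * u = 1 ∧ ¬ PermContainsPattern u ![4, 3, 2, 1] ∧ ¬ PermContainsPattern u ![1, 3, 2]) ∧
      ∀ i, u (Fin.rev i) = Fin.rev (u i)} = 1 ∧ (1 : ℕ) / 2 = 0 :=
  ⟨card_centrosymmetric_av4321_av132 1, rfl⟩

/-- Counterexample to the printed value at `n = 2`: `CI_2(4321, 132) = {12, 21}` has two elements, not `⌊2/2⌋ = 1`.
[cite: BarnabeiBonettiSilimbani2011, Theorem 14 (i) (arXiv 0812.0463; printed `⌊n/2⌋`)] -/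
theorem card_centrosymmetric_av4321_av132_two :
    Nat.card {u : Perm (Fin 2) // (u * u = 1 ∧ ¬ PermContainsPattern u ![4, 3, 2, 1] ∧ ¬ PermContainsPattern u ![1, 3, 2]) ∧
      ∀ i, u (Fin.rev i) = Fin.rev (u i)} = 2 ∧ (2 : ℕ) / 2 = 1 :=
  ⟨card_centrosymmetric_av4321_av132 2, rfl⟩

/-- The transposition `21 ∈ CI_2(4321, 132)` and the identity `12 ∈ CI_2(4321, 132)` are two distinct elements
(explicit witnesses for the correction). [cite: BarnabeiBonettiSilimbani2011, §7 (definition of `CI_n`; arXiv 0812.0463)] -/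
theorem swap_mem_centrosymmetric_av4321_av132 :
    ((swap (0 : Fin 2) 1 * swap (0 : Fin 2) 1 = 1 ∧ ¬ PermContainsPattern (swap (0 : Fin 2) 1) ![4, 3, 2, 1] ∧
        ¬ PermContainsPattern (swap (0 : Fin 2) 1) ![1, 3, 2]) ∧
      ∀ i : Fin 2, swap (0 : Fin 2) 1 (Fin.rev i) = Fin.rev (swap (0 : Fin 2) 1 i)) ∧
    (((1 : Perm (Fin 2)) * 1 = 1 ∧ ¬ PermContainsPattern (1 : Perm (Fin 2)) ![4, 3, 2, 1] ∧
        ¬ PermContainsPattern (1 : Perm (Fin 2)) ![1, 3, 2]) ∧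
      ∀ i : Fin 2, (1 : Perm (Fin 2)) (Fin.rev i) = Fin.rev ((1 : Perm (Fin 2)) i)) ∧ swap (0 : Fin 2) 1 ≠ 1 := by
  refine ⟨⟨⟨swap_mul_self _ _, not_contains_of_lt _ _ (by norm_num), not_contains_of_lt _ _ (by norm_num)⟩,
    by decide⟩, ⟨⟨one_mul _, not_contains_of_lt _ _ (by norm_num), not_contains_of_lt _ _ (by norm_num)⟩,
    fun i => rfl⟩, fun h => ?_⟩
  have := Equiv.ext_iff.1 h 0
  exact absurd this (by decide)

end PermContainsPattern

end Literature.Combinatorics.Enumerative
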